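import Literature.IUT.HodgeTheaters.InitialThetaDataTorsionCuspModelGeometry
import Literature.IUT.HodgeTheaters.PuncturedEllipticCoveringsCusps
import HarnessLib

/-!
# [IUTchI] §1 p.37 / [EtTh] Def 2.1, Rmk 2.1.1: the CUSP GALOIS ACTION of the group-ring two-step model — abc-iut-L5-t1's
# `CuspGalois` INHABITED at an `l`-cusp datum carrying the `l`-torsion monodromy (NV-L5 row «JOINT-NV-CG (l cusps)», part B4)

S. Mochizuki, *Inter-universal Teichmüller theory I*, kurims manuscript (May 2020), §1 p. 37 «`ε⁰` for the unique zero
cusp … `ε′, ε″` for the two cusps of `X̲` that lie over `ε`», p. 38 «`ι` induces an isomorphism `I_{ε′} ≅ I_{ε″}`»; [EtTh]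
Def 2.1 p. 36 «a free `(ℤ/lℤ)`-module `Q` of rank `1` … the corresponding covering `X̲^log → X^log`», Rmk 2.1.1 p. 33 («`ι`
acts on `Q` by `−1`») [claim: Mochizuki2012, status: disputed] (D-0012 claim key; series status DISPUTED — a MODEL of the
cell's `π₁`-interface structures; nothing of the series is asserted; no side taken on [IUTchIII] Cor. 3.12).

## WHAT (continuing parts B1–B3; design memo HOME/staging/L5/L5-t8/g7/STEP0-jointNV-CG.md)

For the `K`-level §1 datum `pedOf₃ G g s h a …` of part B2 (cusps `T ⧸ ℤ·g`, `D_q = G × ⟨igen q⟩`, inertia vectors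
`ivec s h q = e_{s(q)h} − e_{s(q)h⁻¹}`): the BASE-POINT CALCULUS `ivecAt h b := e_{bh} − e_{bh⁻¹}`, `transl_ivecAt`,
`outU_inr_ivecAt` (the sign `ε(u)` and the inversion cancel), **`conj_igen`**: `d · igen_q · d⁻¹ = v_{s(q)^u · t_d}` —
conjugation MOVES the inertia vector over the cusp `act d q` (obstruction (O2) of the memo resolved: translations by
`t ∉ ℤ·g` do NOT centralise the decomposition groups); **`cuspGalois₃ … : (pedOf₃ …).CuspGalois`** — abc-iut-L5-t1's
interface INHABITED (`act := cuspAct g ∘ proj ∘ snd`, the affine action `⟨t, u⟩ · q = [t] · q^u`; `act_decomp`/`eq_of_conj`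
by the base-point calculus; `free`/`transitive`/`exists_generator`: `[a]` generates the prime-order `T/ℤ·g`;
`conj_mul_mem_PiXbar`: «`ι` acts on `Q` by `−1`»; `act_ε0`/`act_ε1`/`act_twoε` by the affine formula); at the
re-geometrised datum **`InitialThetaData.cuspGaloisRegeom₃ D₀ : D₀.regeom₃.geom.pe.CuspGalois`** and the first JOINT
statements **`nonempty_cuspGalois_and_unramified_regeom₃`** / **`exists_cuspGalois_and_unramifiedTorsionMonodromy`**: ONE
datum carrying `{CG, M′ : UnramifiedTorsionMonodromy (⊇ M, hI)}` — impossible at every earlier model (`IsEmpty CuspGalois`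
at the 4-label data, `InitialThetaDataTorsionMonodromyModelNoCuspGalois.lean`; product ambients carry no `M`).

HONEST LABEL «[model; `E[l]`-twisted finite shadow `U ⋊ E[l]`; `l` cusps; CG INHABITED]»: the cusp SET `E_F[l]/ℤ·g` and
the Galois action on `E_F[l]` are as in print; `Δ_X`, the inertia module and the decomposition groups are synthetic.
`ModLCuspLaws`/`ArrowCoveringClaims`/`hS` at this datum = parts B5–B6 (not claimed here).  Instantiated ≠ endorsed;
typed ≠ proved; no side taken on [IUTchIII] Cor. 3.12.
-/

noncomputable section

namespace Literature.IUT.HodgeTheaters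

universe u

namespace TorsionCuspModel
open Literature.AnabelianGeometry.AbsoluteAnabelian Topology TorsionMonodromyModel
open Literature.AnabelianGeometry.EtaleTheta.SettingModel
open scoped WeierstrassCurve.Affine Classical Pointwise

variable {F : Type u} [Field F] {E : WeierstrassCurve F} {Fbar : Type u} [Field Fbar] [Algebra F Fbar] {l : ℕ}

/-! ## The base-point calculus of inertia vectors -/
/-- The inertia vector based at `b ∈ T`: `v_b := e_{bh} − e_{bh⁻¹}` (so `ivec s h q = v_{s(q)}`). [cite: Mochizuki2012, IUTchI §1 p.37] -/
def ivecAt (h b : Tors E Fbar l) : U E Fbar l := U.e (b * h) * (U.e (b * h⁻¹))⁻¹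
/-- [cite: Mochizuki2012, IUTchI §1 p.37] -/
theorem ivec_eq_ivecAt {g : Tors E Fbar l} (s : Tors E Fbar l ⧸ Subgroup.zpowers g → Tors E Fbar l) (h : Tors E Fbar l)
    (q : Tors E Fbar l ⧸ Subgroup.zpowers g) : ivec s h q = ivecAt h (s q) := rfl

/-- Coordinates of `v_b`: `v_b(Q) = [Q = bh] − [Q = bh⁻¹]`. [cite: Mochizuki2012, IUTchI §1 p.37] -/
theorem toAdd_ivecAt_apply (h b Q : Tors E Fbar l) : Multiplicative.toAdd (ivecAt h b) Q =
    (if Q = b * h then 1 else 0) - (if Q = b * h⁻¹ then 1 else 0) := by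
  rw [ivecAt, U.toAdd_mul_apply, U.toAdd_inv_apply, U.toAdd_e_apply, U.toAdd_e_apply, sub_eq_add_neg]

/-- Translation moves the base point: `P · v_b = v_{bP}`. [cite: Mochizuki2012, IUTchI §1 p.37] -/
theorem transl_ivecAt (P h b : Tors E Fbar l) : transl E Fbar l P (ivecAt h b) = ivecAt h (b * P) := by
  rw [ivecAt, map_mul, map_inv, transl_e, transl_e, ivecAt, mul_right_comm b h P, mul_right_comm b h⁻¹ P]

/-- `act (1, u)⁻¹ Q = Q^u` (`u = ±1`). [cite: Mochizuki2012, IUTchI Def 3.1 (b) p.61] -/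
theorem act_inr_symm_apply (u : ℤˣ) (Q : Tors E Fbar l) : (act F E Fbar l (1, u)).symm Q = Q ^ (u : ℤ) := by
  have hact : act F E Fbar l (1, u) = sgnRep E Fbar l u := by
    rw [act, MonoidHom.noncommCoprod_apply, map_one, one_mul]
  apply (act F E Fbar l (1, u)).injective
  rw [MulEquiv.apply_symm_apply, hact, sgnRep_apply_eq_zpow, ← zpow_mul, ← Units.val_mul, Int.units_mul_self,
    Units.val_one, zpow_one]

/-- The involution side acts on base points by inversion and the sign cancels: `(1, u) · v_b = v_{b^u}`.
[cite: Mochizuki2012, IUTchI §1 p.38] -/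
theorem outU_inr_ivecAt (u : ℤˣ) (h b : Tors E Fbar l) : outU E l (1, u) (ivecAt h b) = ivecAt h (b ^ (u : ℤ)) := by
  refine U.ext fun Q => ?_
  rw [toAdd_outU_apply, act_inr_symm_apply, toAdd_ivecAt_apply, toAdd_ivecAt_apply]
  rcases Int.units_eq_one_or u with rfl | rfl
  · simp only [sgnScalar, Units.val_one, Int.cast_one, one_mul, zpow_one]
  · simp only [sgnScalar, Units.val_neg, Units.val_one, Int.cast_neg, Int.cast_one, zpow_neg, zpow_one, neg_mul,
      one_mul, neg_sub]
    have e1 : (Q⁻¹ = b * h ↔ Q = h⁻¹ * b⁻¹) := by rw [inv_eq_iff_eq_inv, mul_inv_rev]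
    have e2 : (Q⁻¹ = b * h⁻¹ ↔ Q = h * b⁻¹) := by rw [inv_eq_iff_eq_inv, mul_inv_rev, inv_inv]
    simp only [e1, e2, mul_comm h⁻¹ b⁻¹, mul_comm h b⁻¹]

/-- `outer q (inl v) = inl (outU q v)` in `Del`. [cite: Mochizuki2012, IUTchI Def 3.1 (c) p.62] -/
theorem outer_inl (q : GalPM F Fbar) (v : U E Fbar l) :
    outer F E Fbar l q (SemidirectProduct.inl v) = SemidirectProduct.inl (outU E l q v) :=
  SemidirectProduct.ext rfl (by rw [outer_apply_right, SemidirectProduct.right_inl, map_one, SemidirectProduct.right_inl])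

/-- Conjugation of a `U`-element inside `Del = U ⋊ T`: `δ v δ⁻¹ = t_δ · v`. [cite: Mochizuki2012, IUTchI §1 p.37] -/
theorem del_conj_inl (δ : Del E Fbar l) (w : U E Fbar l) :
    δ * SemidirectProduct.inl w * δ⁻¹ = SemidirectProduct.inl (transl E Fbar l δ.right w) := by
  conv_lhs => rw [← SemidirectProduct.inl_left_mul_inr_right δ]
  rw [show (SemidirectProduct.inl δ.left * SemidirectProduct.inr δ.right) * SemidirectProduct.inl w *
      (SemidirectProduct.inl δ.left * SemidirectProduct.inr δ.right)⁻¹ =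
      SemidirectProduct.inl δ.left * (SemidirectProduct.inr δ.right * SemidirectProduct.inl w *
        (SemidirectProduct.inr δ.right)⁻¹) * (SemidirectProduct.inl δ.left)⁻¹ by group,
    ← map_inv, ← SemidirectProduct.inl_aut, ← map_inv, ← map_mul, ← map_mul, mul_comm δ.left, mul_inv_cancel_right]

/-- **Conjugation of an inertia-type element in `DihU`**: `d · (v, 1, 1) · d⁻¹ = (t_d · ((1,u_d) · v), 1, 1)`.
[cite: Mochizuki2012, IUTchI §1 p.37] -/
theorem conj_inl_inl (d : DihU F E Fbar l) (v : U E Fbar l) :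
    d * SemidirectProduct.inl (SemidirectProduct.inl v) * d⁻¹ =
      SemidirectProduct.inl (SemidirectProduct.inl (transl E Fbar l d.left.right (outU E l (1, d.right) v))) := by
  conv_lhs => rw [← SemidirectProduct.inl_left_mul_inr_right d]
  rw [show (SemidirectProduct.inl d.left * SemidirectProduct.inr d.right) *
      SemidirectProduct.inl (SemidirectProduct.inl v) * (SemidirectProduct.inl d.left * SemidirectProduct.inr d.right)⁻¹ =
      SemidirectProduct.inl d.left * (SemidirectProduct.inr d.right * SemidirectProduct.inl (SemidirectProduct.inl v) *
        (SemidirectProduct.inr d.right)⁻¹) * (SemidirectProduct.inl d.left)⁻¹ by group,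
    ← map_inv, ← SemidirectProduct.inl_aut, outerK_apply, outer_inl, ← map_inv, ← map_mul, ← map_mul, del_conj_inl]

/-- **`d · igen_q · d⁻¹ = v_{s(q)^u · t_d}`** for `d = ⟨⟨f, t_d⟩, u⟩`: conjugation moves the inertia vector of the cusp `q`
to the base point `s(q)^u t_d`, over the cusp `act d q = [t_d] · q^u`. [cite: Mochizuki2012, IUTchI §1 p.37] -/
theorem conj_igen {g : Tors E Fbar l} (s : Tors E Fbar l ⧸ Subgroup.zpowers g → Tors E Fbar l) (h : Tors E Fbar l)
    (q : Tors E Fbar l ⧸ Subgroup.zpowers g) (d : DihU F E Fbar l) :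
    d * igen (F := F) s h q * d⁻¹ =
      SemidirectProduct.inl (SemidirectProduct.inl (ivecAt h ((s q) ^ (d.right : ℤ) * d.left.right))) := by
  rw [igen, ivec_eq_ivecAt, conj_inl_inl, outU_inr_ivecAt, transl_ivecAt]

/-- Conjugating `G × D` inside `G × DihU` conjugates the finite factor. [cite: Mochizuki2012, IUTchI §1 p.37] -/
theorem conj_smul_liftU {G : Type u} [Group G] (x : G × DihU F E Fbar l) (D : Subgroup (DihU F E Fbar l)) :
    MulAut.conj x • liftU G D = liftU G (MulAut.conj x.2 • D) := by
  ext y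
  rw [Subgroup.mem_pointwise_smul_iff_inv_smul_mem, mem_liftU, mem_liftU, Subgroup.mem_pointwise_smul_iff_inv_smul_mem]
  rfl

/-- Conjugating a cyclic subgroup conjugates its generator. [cite: Mochizuki2012, IUTchI §1 p.37] -/
theorem conj_smul_zpowers {H : Type u} [Group H] (x v : H) :
    MulAut.conj x • Subgroup.zpowers v = Subgroup.zpowers (x * v * x⁻¹) := by
  rw [Subgroup.pointwise_smul_def, MonoidHom.map_zpowers]
  rfl

/-- `liftU G` is injective on subgroups of the finite factor. [cite: Mochizuki2012, IUTchI §1 p.37] -/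
theorem liftU_injective (G : Type u) [Group G] : Function.Injective (liftU (F := F) (E := E) (Fbar := Fbar) (l := l) G) :=
  fun _ _ h => Subgroup.comap_injective Prod.snd_surjective h

/-- `liftU G D` is closed (the finite factor is discrete). [cite: Mochizuki2012, IUTchI §1 p.37] -/
theorem isClosed_liftU (G : Type u) [Group G] [TopologicalSpace G] (D : Subgroup (DihU F E Fbar l)) :
    IsClosed (liftU G D : Set (G × DihU F E Fbar l)) :=
  (isClosed_discrete (D : Set (DihU F E Fbar l))).preimage continuous_snd

/-- Plumbing: `a² = 1 → a = 1` in the `l`-torsion (`l` an odd prime). [cite: Mochizuki2012, IUTchI Def 3.1 (c) p.62] -/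
theorem eq_one_of_sq_eq_one (hl : l.Prime) (h5 : 5 ≤ l) {a : Tors E Fbar l} (ha : a ^ 2 = 1) : a = 1 := by
  have h2 : orderOf a ∣ 2 := orderOf_dvd_of_pow_eq_one ha
  have hl' : orderOf a ∣ l := orderOf_dvd_of_pow_eq_one (Tors.pow_l a)
  have hcop : Nat.Coprime 2 l := (Nat.coprime_primes Nat.prime_two hl).mpr (by omega)
  exact orderOf_eq_one_iff.mp (Nat.eq_one_of_dvd_coprimes hcop h2 hl')

/-- The SUPPORT EQUATION behind `eq_of_conj`: if `v_b ^ n = v_{b'}` (with `h² ≠ 1 ≠ h⁴`, so the two points of each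
support are distinct) then `b = b'`. [cite: Mochizuki2012, IUTchI §1 p.37] -/
theorem base_eq_of_zpow_ivecAt_eq (hl : l.Prime) {h : Tors E Fbar l} (hh2 : h ^ 2 ≠ 1) (hh4 : h ^ 4 ≠ 1)
    {b b' : Tors E Fbar l} {n : ℤ} (hn : ivecAt h b ^ n = ivecAt h b') : b = b' := by
  haveI : Fact (1 < l) := ⟨hl.one_lt⟩
  have hhh : h * h ≠ 1 := by rw [← pow_two]; exact hh2
  have key : ∀ Q, (n : ZMod l) * ((if Q = b * h then 1 else 0) - (if Q = b * h⁻¹ then 1 else 0)) =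
      (if Q = b' * h then 1 else 0) - (if Q = b' * h⁻¹ then 1 else 0) := fun Q => by
    have := congrArg (fun f : U E Fbar l => Multiplicative.toAdd f Q) hn
    simp only [toAdd_zpow, Pi.smul_apply, zsmul_eq_mul, toAdd_ivecAt_apply] at this
    exact this
  have hne : b' * h ≠ b' * h⁻¹ := fun e => hhh (by
    have := mul_left_cancel e; rw [eq_inv_iff_mul_eq_one] at this; exact this)
  have k1 := key (b' * h)
  rw [if_pos rfl, if_neg hne] at k1
  by_cases e1 : b' * h = b * h
  · exact (mul_right_cancel e1).symm
  · rw [if_neg e1] at k1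
    by_cases e2 : b' * h = b * h⁻¹
    · -- `b = b' h²`: evaluate at `b' h⁻¹`, where the left side vanishes and the right side is `−1`
      have hb : b = b' * h * h := by rw [e2, inv_mul_cancel_right]
      have k2 := key (b' * h⁻¹)
      have n1 : b' * h⁻¹ ≠ b * h := by
        rw [hb]; intro e; apply hh4
        have e' : h⁻¹ = h * h * h := by
          rw [mul_assoc, mul_assoc] at e
          have := mul_left_cancel e
          rw [this, mul_assoc]
        calc h ^ 4 = h * (h * h * h) := by simp only [pow_succ, pow_zero, one_mul, mul_assoc]
          _ = 1 := by rw [← e', mul_inv_cancel]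
      have n2 : b' * h⁻¹ ≠ b * h⁻¹ := fun e => e1 (by rw [mul_right_cancel e])
      have n3 : b' * h⁻¹ ≠ b' * h := fun e => hne e.symm
      rw [if_neg n1, if_neg n2, if_neg n3, if_pos rfl, sub_zero, mul_zero, zero_sub] at k2
      exact absurd k2.symm (neg_ne_zero.mpr one_ne_zero)
    · rw [if_neg e2, sub_zero, mul_zero, sub_zero] at k1
      exact absurd k1 zero_ne_one

/-! ## The cusp Galois action at `pedOf₃` -/

section CuspGalois

variable (G : Type u) [Group G] [TopologicalSpace G] [IsTopologicalGroup G] [CompactSpace G]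
  [TotallyDisconnectedSpace G] [E.IsElliptic] [NeZero l]
  {g : Tors E Fbar l} (s : Tors E Fbar l ⧸ Subgroup.zpowers g → Tors E Fbar l) (h a : Tors E Fbar l)
  (hl : l.Prime) (ha : a ∉ Subgroup.zpowers g) (h5 : 5 ≤ l) (h6 : l.Coprime 6)

/-- **abc-iut-L5-t1's `CuspGalois` INHABITED at the `K`-level datum `pedOf₃`** of the group-ring two-step model: the
affine action of `Π_{C_K} = G × DihU` on the `l` cusps `E_F[l]/ℤ·g` through `DihU ↠ E_F[l] ⋊ {±1}`, with all ten laws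
(«`Gal(X̲/X) ≅ Q` acts simply transitively on the cusps of `X̲` over the cusp of `X`; `ι` acts on `Q` by `−1`, fixes `ε⁰`,
switches `ε′, ε″`»).  Hypotheses: `#E_F[l](F̄) = l²`, `g ≠ 1`, `s` a section of `E_F[l] ↠ E_F[l]/ℤ·g`, `h² = a ∉ ℤ·g`.
[cite: Mochizuki2012, IUTchI §1 p.37] -/
def cuspGalois₃ (hg : g ≠ 1) (hcard : Nat.card (Tors E Fbar l) = l ^ 2)
    (hs : ∀ q : Tors E Fbar l ⧸ Subgroup.zpowers g, (QuotientGroup.mk (s q) : _ ⧸ Subgroup.zpowers g) = q)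
    (hh : h ^ 2 = a) : (pedOf₃ F E Fbar l G g s h a hl ha h5 h6).CuspGalois :=
  haveI : Fact l.Prime := ⟨hl⟩
  let D := pedOf₃ F E Fbar l G g s h a hl ha h5 h6
  let actK : (G × DihU F E Fbar l) →* Equiv.Perm (Tors E Fbar l ⧸ Subgroup.zpowers g) :=
    (cuspAct g).comp ((proj F E Fbar l).comp (MonoidHom.snd G (DihU F E Fbar l)))
  have actK_apply : ∀ (x : G × DihU F E Fbar l) (q : Tors E Fbar l ⧸ Subgroup.zpowers g),
      actK x q = (QuotientGroup.mk x.2.left.right : _ ⧸ Subgroup.zpowers g) * q ^ (x.2.right : ℤ) := fun _ _ => rfl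
  -- `h² = a ∉ ℤ·g`, so `h² ≠ 1` and `h⁴ = a² ≠ 1` (`l` odd)
  have ha1 : a ≠ 1 := fun h1 => ha (h1 ▸ one_mem _)
  have hh2 : h ^ 2 ≠ 1 := fun e => ha1 (hh ▸ e)
  have hh4 : h ^ 4 ≠ 1 := fun e => ha1 (eq_one_of_sq_eq_one hl h5 (by rw [← hh, ← pow_mul]; exact e))
  -- the base point of `d · igen_q · d⁻¹` lies over the cusp `act d q`
  have hbase : ∀ (d : DihU F E Fbar l) (q : Tors E Fbar l ⧸ Subgroup.zpowers g),
      (QuotientGroup.mk ((s q) ^ (d.right : ℤ) * d.left.right) : _ ⧸ Subgroup.zpowers g) = actK (1, d) q :=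
    fun d q => by rw [actK_apply, QuotientGroup.mk_mul, QuotientGroup.mk_zpow, hs, mul_comm]
  { act := actK
    act_decomp := fun x q => by
      -- the conjugate `x·D_q·x⁻¹` has inertia vector based at `b := s(q)^{u_x}·t_x`, over the cusp `act x q`;
      -- correct it by the `ℤ·g`-translation `t₀⁻¹`, `t₀ := b·s(act x q)⁻¹ ∈ ℤ·g`
      obtain ⟨b, hbdef⟩ : ∃ b : Tors E Fbar l, b = (s q) ^ (x.2.right : ℤ) * x.2.left.right := ⟨_, rfl⟩
      have hb : (QuotientGroup.mk b : _ ⧸ Subgroup.zpowers g) = actK x q := by rw [hbdef]; exact hbase x.2 q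
      obtain ⟨t₀, ht₀def⟩ : ∃ t₀ : Tors E Fbar l, t₀ = b * (s (actK x q))⁻¹ := ⟨_, rfl⟩
      have ht₀ : t₀ ∈ Subgroup.zpowers g := by
        rw [ht₀def, ← QuotientGroup.eq_one_iff, QuotientGroup.mk_mul, QuotientGroup.mk_inv, hb, hs, mul_inv_cancel]
      obtain ⟨d, hddef⟩ : ∃ d : DihU F E Fbar l, d = SemidirectProduct.inl (SemidirectProduct.inr t₀⁻¹) := ⟨_, rfl⟩
      have hd1 : d.right = 1 := by rw [hddef, SemidirectProduct.right_inl]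
      have hd2 : d.left.right = t₀⁻¹ := by rw [hddef, SemidirectProduct.left_inl, SemidirectProduct.right_inr]
      let t : D.PiC := ((1 : G), d)
      refine ⟨t, ⟨mem_liftU.mpr ((mem_dX_iff _).mpr hd1),
        mem_liftU.mpr ((mem_dC_iff _ _).mpr (hd2 ▸ Subgroup.inv_mem _ ht₀))⟩, ?_⟩
      show MulAut.conj (G := G × DihU F E Fbar l) (t * x) • liftU G (Subgroup.zpowers (igen (F := F) s h q)) =
        liftU G (Subgroup.zpowers (igen (F := F) s h (actK x q)))
      rw [conj_smul_liftU, conj_smul_zpowers]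
      congr 2
      show d * x.2 * igen (F := F) s h q * (d * x.2)⁻¹ = igen (F := F) s h (actK x q)
      calc d * x.2 * igen (F := F) s h q * (d * x.2)⁻¹ = d * (x.2 * igen (F := F) s h q * x.2⁻¹) * d⁻¹ := by group
        _ = SemidirectProduct.inl (SemidirectProduct.inl (ivecAt h (b * t₀⁻¹))) := by
          rw [conj_igen, conj_inl_inl, hd1, hd2, outU_inr_ivecAt, Units.val_one, zpow_one, transl_ivecAt, hbdef]
        _ = igen (F := F) s h (actK x q) := by
          rw [igen, ivec_eq_ivecAt, ht₀def, mul_inv_rev, inv_inv, mul_comm (s (actK x q)) b⁻¹, mul_inv_cancel_left]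
    eq_of_conj := fun q q' t ht hconj => by
      have ht1 : t.2.right = 1 := (mem_dX_iff _).mp (mem_liftU.mp ht.1)
      have ht2 : t.2.left.right ∈ Subgroup.zpowers g := (mem_dC_iff _ _).mp (mem_liftU.mp ht.2)
      have h1 : Subgroup.zpowers (t.2 * igen (F := F) s h q * t.2⁻¹) = Subgroup.zpowers (igen (F := F) s h q') := by
        apply liftU_injective G
        rw [← conj_smul_zpowers, ← conj_smul_liftU]
        exact hconj
      rw [conj_igen, ht1, Units.val_one, zpow_one] at h1
      have hmem : igen (F := F) s h q' ∈
          Subgroup.zpowers (SemidirectProduct.inl (SemidirectProduct.inl (ivecAt h (s q * t.2.left.right))) :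
            DihU F E Fbar l) := by
        rw [h1]; exact Subgroup.mem_zpowers _
      obtain ⟨n, hn⟩ := Subgroup.mem_zpowers_iff.mp hmem
      rw [igen, ivec_eq_ivecAt, ← map_zpow, ← map_zpow] at hn
      have hb := base_eq_of_zpow_ivecAt_eq hl hh2 hh4
        (SemidirectProduct.inl_injective (SemidirectProduct.inl_injective hn))
      rw [← hs q, ← hs q', ← hb, QuotientGroup.mk_mul, (QuotientGroup.eq_one_iff _).mpr ht2, mul_one]
    isClosed_decomp := fun q => isClosed_liftU G _
    free := fun x hx (q : Tors E Fbar l ⧸ Subgroup.zpowers g) hq => by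
      have hu : x.2.right = 1 := (mem_dX_iff _).mp (mem_liftU.mp hx)
      refine ⟨hx, mem_liftU.mpr ((mem_dC_iff _ _).mpr ?_)⟩
      have this : (QuotientGroup.mk x.2.left.right : _ ⧸ Subgroup.zpowers g) * q ^ (x.2.right : ℤ) = q := hq
      rw [hu, Units.val_one, zpow_one, mul_eq_right] at this
      exact (QuotientGroup.eq_one_iff _).mp this
    transitive := fun (q q' : Tors E Fbar l ⧸ Subgroup.zpowers g) => by
      refine ⟨((1 : G), SemidirectProduct.inl (SemidirectProduct.inr (s q' * (s q)⁻¹))),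
        mem_liftU.mpr ((mem_dX_iff _).mpr rfl), ?_⟩
      show (QuotientGroup.mk (s q' * (s q)⁻¹) : _ ⧸ Subgroup.zpowers g) * q ^ ((1 : ℤˣ) : ℤ) = q'
      rw [Units.val_one, zpow_one, QuotientGroup.mk_mul, QuotientGroup.mk_inv, hs, hs, inv_mul_cancel_right]
    exists_generator := by
      -- `Gal(X̲/X) ≅ E_F[l]/ℤ·g` has prime order `l`, so the translation by `[a] ≠ 1` generates the action of `Π_X`
      let φ : Tors E Fbar l →* G × DihU F E Fbar l :=
        (MonoidHom.inr G (DihU F E Fbar l)).comp (SemidirectProduct.inl.comp SemidirectProduct.inr)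
      have hφX : ∀ t, φ t ∈ liftU G (dX F E Fbar l) := fun t => mem_liftU.mpr ((mem_dX_iff _).mpr rfl)
      have hφact : ∀ (t : Tors E Fbar l) (q : Tors E Fbar l ⧸ Subgroup.zpowers g),
          actK (φ t) q = (QuotientGroup.mk t : _ ⧸ Subgroup.zpowers g) * q := fun t q => by
        rw [actK_apply]
        show (QuotientGroup.mk t : _ ⧸ Subgroup.zpowers g) * q ^ ((1 : ℤˣ) : ℤ) = _
        rw [Units.val_one, zpow_one]
      refine ⟨φ a, hφX a, fun x hx => ?_⟩
      have hu : x.2.right = 1 := (mem_dX_iff _).mp (mem_liftU.mp hx)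
      have habar : (QuotientGroup.mk a : _ ⧸ Subgroup.zpowers g) ≠ 1 :=
        fun h1 => ha ((QuotientGroup.eq_one_iff a).mp h1)
      have hcardQ : Nat.card (Tors E Fbar l ⧸ Subgroup.zpowers g) = l := by
        have h1 := (Subgroup.zpowers g).card_mul_index
        rw [Tors.card_zpowers hl hg, hcard, sq, Subgroup.index] at h1
        exact Nat.eq_of_mul_eq_mul_left hl.pos h1
      obtain ⟨n, hn⟩ := Subgroup.mem_zpowers_iff.mp
        (mem_zpowers_of_prime_card hcardQ habar (g' := (QuotientGroup.mk x.2.left.right : _ ⧸ Subgroup.zpowers g)))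
      have e : actK (φ a) ^ n = actK (φ (a ^ n)) :=
        ((congrArg actK (map_zpow φ a n)).trans (map_zpow actK (φ a) n)).symm
      refine ⟨n, ?_⟩
      show actK x = actK (φ a) ^ n
      rw [e]
      ext q
      rw [actK_apply, hu, Units.val_one, zpow_one, hφact, QuotientGroup.mk_zpow, hn]
    conj_mul_mem_PiXbar := fun c hc hcX x hx => by
      have hcu : c.2.right ≠ 1 := fun h1 => hcX (mem_liftU.mpr ((mem_dX_iff _).mpr h1))
      have hcu' : c.2.right = -1 := (Int.units_eq_one_or c.2.right).resolve_left hcu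
      have hxu : x.2.right = 1 := (mem_dX_iff _).mp (mem_liftU.mp hx)
      refine ⟨mem_liftU.mpr ((mem_dX_iff _).mpr ?_), mem_liftU.mpr ((mem_dC_iff _ _).mpr ?_)⟩
      · show (c.2 * x.2 * c.2⁻¹ * x.2).right = 1
        rw [SemidirectProduct.mul_right, SemidirectProduct.mul_right, SemidirectProduct.mul_right,
          SemidirectProduct.inv_right, hcu', hxu, mul_one, mul_one, mul_inv_cancel]
      · -- the `E_F[l]`-component of `c x c⁻¹ x` is `t_c · t_x⁻¹ · t_c⁻¹ · t_x = 1`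
        have key : (proj F E Fbar l (c.2 * x.2 * c.2⁻¹ * x.2)).left = 1 := by
          rw [map_mul, map_mul, map_mul, map_inv]
          simp only [SemidirectProduct.mul_left, SemidirectProduct.inv_left, SemidirectProduct.mul_right,
            SemidirectProduct.inv_right, proj_apply_right, hcu', hxu, mul_one, Int.units_inv_eq_self,
            Int.units_mul_self, map_one, MulAut.one_apply, sgnRep_apply_eq_zpow, Units.val_neg, Units.val_one,
            zpow_neg, zpow_one, inv_inv]
          rw [mul_comm _ (proj F E Fbar l c.2).left⁻¹, inv_mul_cancel_left, inv_mul_cancel]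
        show (c.2 * x.2 * c.2⁻¹ * x.2).left.right ∈ Subgroup.zpowers g
        rw [← proj_apply_left, key]
        exact one_mem _
    act_ε0 := fun c hc => by
      have hcL : c.2.left.right ∈ Subgroup.zpowers g := (mem_dC_iff _ _).mp (mem_liftU.mp hc)
      show (QuotientGroup.mk c.2.left.right : _ ⧸ Subgroup.zpowers g) * 1 ^ (c.2.right : ℤ) = 1
      rw [one_zpow, mul_one]
      exact (QuotientGroup.eq_one_iff _).mpr hcL
    act_ε1 := fun c hc hcX => by
      have hcL : c.2.left.right ∈ Subgroup.zpowers g := (mem_dC_iff _ _).mp (mem_liftU.mp hc)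
      have hcu : c.2.right ≠ 1 := fun h1 => hcX (mem_liftU.mpr ((mem_dX_iff _).mpr h1))
      have hcu' : c.2.right = -1 := (Int.units_eq_one_or c.2.right).resolve_left hcu
      show (QuotientGroup.mk c.2.left.right : _ ⧸ Subgroup.zpowers g) *
          (QuotientGroup.mk a : Tors E Fbar l ⧸ Subgroup.zpowers g) ^ (c.2.right : ℤ) =
        (QuotientGroup.mk a : Tors E Fbar l ⧸ Subgroup.zpowers g)⁻¹
      rw [hcu', Units.val_neg, Units.val_one, zpow_neg, zpow_one, (QuotientGroup.eq_one_iff _).mpr hcL, one_mul]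
    act_twoε := fun x hx hx0 => by
      left
      have hu : x.2.right = 1 := (mem_dX_iff _).mp (mem_liftU.mp hx)
      have h0 : (QuotientGroup.mk x.2.left.right : _ ⧸ Subgroup.zpowers g) * 1 ^ (x.2.right : ℤ) =
        QuotientGroup.mk a := hx0
      rw [one_zpow, mul_one] at h0
      show (QuotientGroup.mk (x.2 * x.2).left.right : _ ⧸ Subgroup.zpowers g) * 1 ^ ((x.2 * x.2).right : ℤ) =
        QuotientGroup.mk a ^ 2
      rw [one_zpow, mul_one, SemidirectProduct.mul_left, hu, map_one, MulAut.one_apply, SemidirectProduct.mul_right,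
        QuotientGroup.mk_mul, h0, pow_two] }

end CuspGalois

end TorsionCuspModel

namespace InitialThetaData

open Literature.AnabelianGeometry.AbsoluteAnabelian TorsionMonodromyModel TorsionCuspModel
open scoped WeierstrassCurve.Affine Classical

variable {F K Fbar : Type u} [Field F] [NumberField F] [Field K] [NumberField K] [Algebra F K] [Field Fbar]
  [Algebra F Fbar] [Algebra K Fbar] {E : WeierstrassCurve F} [E.IsElliptic] {l : ℕ} {Pb : BadPlacePredicates K}

/-- **abc-iut-L5-t1's `CuspGalois` INHABITED at the re-geometrised initial Θ-datum `regeom₃`** (group-ring two-step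
model, `l` cusps `E_F[l](F̄)/ℤ·g`, `G_K` acting trivially on the finite factor): the term `cuspGalois₃` at
`s := Quotient.out`, `h := a^{(l+1)/2}` (so `h² = a^{l+1} = a`). [cite: Mochizuki2012, IUTchI §1 p.37] -/
def cuspGaloisRegeom₃ (D₀ : InitialThetaData F K Fbar E l Pb) : D₀.regeom₃.geom.pe.CuspGalois :=
  haveI := D₀.isAlgClosure
  haveI := D₀.isScalarTower
  haveI : NeZero l := ⟨D₀.l_prime.ne_zero⟩
  haveI : CompactSpace (galoisSubgroupOf F K Fbar) :=
    isCompact_iff_compactSpace.mp (ThetaGeometryModel.isClosed_galoisSubgroupOf F K Fbar).isCompact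
  TorsionCuspModel.cuspGalois₃ (galoisSubgroupOf F K Fbar) Quotient.out (D₀.coGen ^ ((l + 1) / 2)) D₀.coGen
    D₀.l_prime D₀.coGen_not_mem D₀.five_le_l (coprime_six_of_prime l D₀.l_prime D₀.five_le_l) D₀.lineGen_ne_one
    D₀.card_tors_eq QuotientGroup.out_eq' (by
      have hodd : l % 2 = 1 := Nat.odd_iff.mp (D₀.l_prime.odd_of_ne_two (by have := D₀.five_le_l; omega))
      have h2 : (l + 1) / 2 * 2 = l + 1 := by omega
      rw [← pow_mul, h2, pow_succ, Tors.pow_l, one_mul])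

/-- **JOINT NON-VACUITY `{CG, M′}` AT ONE DATUM** (NV-L5 row «JOINT-NV-CG (l cusps)», parts B3–B4): the re-geometrised
datum `regeom₃` carries BOTH abc-iut-L5-t1's cusp Galois action `CuspGalois` AND this lineage's
`UnramifiedTorsionMonodromy` (`⊇ {M, hI}`) — jointly impossible at every earlier model of the cell (the 4-label data
have `IsEmpty CuspGalois`, `InitialThetaDataTorsionMonodromyModelNoCuspGalois.lean`; product ambients carry no `M`).
The laws `ModLCuspLaws`/`ArrowCoveringClaims`/`hS` at this datum are NOT claimed here (parts B5–B6).
[cite: Mochizuki2012, IUTchI Def 6.1 (v) p.158] -/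
theorem nonempty_cuspGalois_and_unramified_regeom₃ (D₀ : InitialThetaData F K Fbar E l Pb) :
    Nonempty D₀.regeom₃.geom.pe.CuspGalois ∧ Nonempty D₀.regeom₃.UnramifiedTorsionMonodromy :=
  ⟨⟨D₀.cuspGaloisRegeom₃⟩, ⟨D₀.unramifiedTorsionMonodromyRegeom₃⟩⟩

/-- **∃-form over the SAME `(V^bad_mod, V̲)` as any given initial Θ-datum**: for every `D₀` there is an initial Θ-datum
`D` with `D.VbadMod = D₀.VbadMod`, `D.V = D₀.V` carrying `{CG, M′ : UnramifiedTorsionMonodromy}` jointly (the binders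
`CG`, `M`, `hI` of abc-iut-L5-d5's `Λ`-assembly and of abc-iut-L5-t4's kits are JOINTLY consistent with Def 3.1).
[cite: Mochizuki2012, IUTchI Def 6.1 (v) p.158] -/
theorem exists_cuspGalois_and_unramifiedTorsionMonodromy (D₀ : InitialThetaData F K Fbar E l Pb) :
    ∃ D : InitialThetaData F K Fbar E l Pb, D.VbadMod = D₀.VbadMod ∧ D.V = D₀.V ∧
      Nonempty D.geom.pe.CuspGalois ∧ Nonempty D.UnramifiedTorsionMonodromy :=
  ⟨D₀.regeom₃, rfl, rfl, ⟨D₀.cuspGaloisRegeom₃⟩, ⟨D₀.unramifiedTorsionMonodromyRegeom₃⟩⟩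

/-- In particular `{CG, M, hI}` jointly, in abc-iut-L5-d5's binder shape (`hI` = «`τ` kills `embK(I_{ε′})`»).
[cite: Mochizuki2012, IUTchI Def 6.1 (v) p.158] -/
theorem exists_cuspGalois_and_torsionMonodromy_tau_inertia (D₀ : InitialThetaData F K Fbar E l Pb) :
    ∃ D : InitialThetaData F K Fbar E l Pb, D.VbadMod = D₀.VbadMod ∧ D.V = D₀.V ∧
      Nonempty D.geom.pe.CuspGalois ∧ ∃ M : D.TorsionMonodromy,
        ∀ k ∈ D.geom.pe.inertia D.geom.pe.ε1, M.tau (D.geom.embK k) = 0 :=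
  ⟨D₀.regeom₃, rfl, rfl, ⟨D₀.cuspGaloisRegeom₃⟩, D₀.unramifiedTorsionMonodromyRegeom₃.toTorsionMonodromy,
    D₀.unramifiedTorsionMonodromyRegeom₃.tau_inertia_ε1⟩

end InitialThetaData
end Literature.IUT.HodgeTheaters
end
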